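import Summits.BirchSwinnertonDyer.BirchSwinnertonDyer.Theorems.ThetaPartnerAtTwoSignedControlAtTwoTwistNotTorsion
import Summits.BirchSwinnertonDyer.BirchSwinnertonDyer.Theorems.ThetaPartnerAtTwoSignedControlAtTwoOfPubTwoNotTorsionH1Sigma
import Summits.BirchSwinnertonDyer.BirchSwinnertonDyer.Theorems.ThetaPartnerAtTwoSignedTransportAtTwoResidualKummer
import HarnessLib

/-!
# TWIST ROAD T4 — K4 `SignedControlAtTwo` BY NAME from {Cassels Prop. 4.13, Prop. 4.12, Poitou–Tate}

Support file for crux `SignedControlAtTwo` (stmt-BirchSwinnertonDyer-20309, line `eulerchar`, stub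
`stub_pubGreenbergI1Two = Cassels ∧ Prop. 4.12 ∧ (I1)`). The lead's definitive door
`SignedEC.signedControlAtTwo_of_pub2_of_h1SigmaDualNotTorsion` / `signedControl_two_allCurves_of_print2NTY` takes the
predicate `SignedEC.H1SigmaDualNotTorsion W 2 κ γ Σ₀` («the dual of `H¹(ℚ_Σ/ℚ_∞, E[2^∞])` is not `Λ`-torsion»,
Greenberg p. 113). T3 (`TwistNotTorsion.not_isTorsion_dual_h1Sigma_of_poitouTate`) produces exactly that predicate from
the tree's canonical Poitou–Tate fact `poitouTate_selmerStructure_duality K` plus `E(K)[p] = 0`; over `ℚ` at `p = 2` on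
the row `GoodSS W 2` the latter is the tree theorem `SignedTransportAtTwo.eq_zero_of_two_nsmul_eq_zero_of_goodSS`, and the
place above `2` is `Rat.HeightOneSpectrum.primesEquiv.symm 2`. Hence:

* `h1SigmaDualNotTorsion_of_poitouTate` — any number field: PT + `E(K)[p] = 0` ⇒ the predicate;
* `h1SigmaDualNotTorsion_two_of_poitouTate_of_goodSS` — `ℚ`, `p = 2`, good supersingular at `2`: PT alone ⇒ the predicate;
* `signedControlAtTwo_of_pub2_of_poitouTate` / `signedControlAtTwo_rtt_of_pub2_of_poitouTate` — BOTH route copies of the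
  crux decl BY NAME from `casselsSurjectivity_H1Sigma ℚ`, `prop412_noFiniteSubmodule_H1Sigma_of_rank_one` and
  `poitouTate_selmerStructure_duality ℚ`: the (I1) conjunct of the stub is REPLACED by the generic published duality
  theorem (MilneADT2006 I.4.10), i.e. K4's residue of record {Cassels, 4.12, (I1)} becomes {Cassels, 4.12, PT}.

HONEST FRAMING. All three inputs remain named `Prop`s of published theorems taken as hypotheses (conditional results);
nothing here proves Cassels' surjectivity, Prop. 4.12 or Poitou–Tate duality, and the crux item is NOT closed by this
file. BSD is not proved by any of this.
-/

set_option linter.dupNamespace false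

noncomputable section

open scoped Classical
open NumberField IsDedekindDomain
open Literature.NumberTheory.EllipticCurves Literature.NumberTheory.EllipticCurves.GreenbergVatsal2000
open Literature.NumberTheory.EllipticCurves.Rank1Residual
open Literature.NumberTheory.GaloisCohomology

namespace Summit.BirchSwinnertonDyer.BirchSwinnertonDyer.Theorems.SignedEC.TwistNotTorsion

section AnyField

variable {K : Type} [Field K] [NumberField K] (W : WeierstrassCurve K) [W.IsElliptic] {p : ℕ} [Fact p.Prime]
  (κ : ZpExtension K p) {γ : Field.absoluteGaloisGroup K}

/-- **Poitou–Tate ⇒ `H1SigmaDualNotTorsion`** (any number field `K`, any `ℤ_p`-extension `κ` with topological generator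
`γ`, good reduction off `S₀ ∪ {v ∣ p}`, a place `v ∋ p`, and `E(K)[p] = 0`): the predicate form of T3
`not_isTorsion_dual_h1Sigma_of_poitouTate` — the lead's `h1SigmaDualNotTorsion_of_relaxedCount` with (I1) replaced by
the canonical Poitou–Tate fact. [cite: GreenbergLNM1716, §4 pp. 113, 115–117, 123–124] [cite: MilneADT2006, Ch. I, Thm. 4.10] -/
theorem h1SigmaDualNotTorsion_of_poitouTate (hPT : poitouTate_selmerStructure_duality K) (hγ : κ.IsTopGenerator γ)
    {S₀ : Set (HeightOneSpectrum (𝓞 K))}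
    (hgood : ∀ u : HeightOneSpectrum (𝓞 K), u ∉ S₀ → ((p : ℕ) : 𝓞 K) ∉ u.asIdeal → W.HasGoodReductionAt u)
    {v : HeightOneSpectrum (𝓞 K)} (hpv : ((p : ℕ) : 𝓞 K) ∈ v.asIdeal)
    (hK : ∀ P : W.toAffine.Point, p • P = 0 → P = 0) : H1SigmaDualNotTorsion W p κ γ S₀ :=
  fun _ _ _ _ dY hbij hT hC ↦ not_isTorsion_dual_h1Sigma_of_poitouTate W p κ hPT hγ hgood hpv hK dY hbij hT hC

end AnyField

section Rat

variable (W : WeierstrassCurve ℚ) [W.IsElliptic] [W.IsGloballyMinimal]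

/-- **Over `ℚ` at `p = 2`, good supersingular at `2`: Poitou–Tate ALONE ⇒ `H1SigmaDualNotTorsion W 2 κ γ Σ₀`** for every
`ℤ₂`-extension `κ`, topological generator `γ` and finite `Σ₀` with good reduction off `Σ₀ ∪ {2}` — `E(ℚ)[2] = 0` on the
row (`SignedTransportAtTwo.eq_zero_of_two_nsmul_eq_zero_of_goodSS`) and the place of `ℚ` above `2`
(`Rat.HeightOneSpectrum.primesEquiv`). [cite: GreenbergLNM1716, §4 pp. 113, 115–117] [cite: MilneADT2006, Ch. I, Thm. 4.10] -/
theorem h1SigmaDualNotTorsion_two_of_poitouTate_of_goodSS (hss : GoodSS W 2)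
    (hPT : poitouTate_selmerStructure_duality ℚ) (κ : ZpExtension ℚ 2) {γ : Field.absoluteGaloisGroup ℚ}
    (hγ : κ.IsTopGenerator γ) (S₀ : Finset (HeightOneSpectrum (𝓞 ℚ)))
    (hgood : ∀ w : HeightOneSpectrum (𝓞 ℚ), w ∉ S₀ → ((2 : ℕ) : 𝓞 ℚ) ∉ w.asIdeal → W.HasGoodReductionAt w) :
    H1SigmaDualNotTorsion W 2 κ γ (↑S₀ : Set (HeightOneSpectrum (𝓞 ℚ))) := by
  have hgood' : ∀ w : HeightOneSpectrum (𝓞 ℚ), w ∉ (↑S₀ : Set (HeightOneSpectrum (𝓞 ℚ))) →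
      ((2 : ℕ) : 𝓞 ℚ) ∉ w.asIdeal → W.HasGoodReductionAt w :=
    fun w hw hpw ↦ hgood w (fun h ↦ hw (Finset.mem_coe.mpr h)) hpw
  -- the place of `ℚ` above `2`
  have hpv : ((2 : ℕ) : 𝓞 ℚ) ∈ ((Rat.HeightOneSpectrum.primesEquiv (R := 𝓞 ℚ)).symm ⟨2, Nat.prime_two⟩).asIdeal :=
    (natCast_mem_asIdeal_iff_eq_primesEquiv_symm _ Nat.prime_two).mpr rfl
  refine h1SigmaDualNotTorsion_of_poitouTate W κ hPT hγ hgood' hpv fun P hP ↦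
    SignedTransportAtTwo.eq_zero_of_two_nsmul_eq_zero_of_goodSS W hss P ?_
  -- (the `DecidableEq ℚ` instance inside the group law of `E(ℚ)` may differ syntactically)
  convert hP

/-- **K4 `SignedControlAtTwo` (route `ThetaPartnerAtTwo`'s decl, BY NAME) from Cassels' Prop. 4.13, Prop. 4.12 and
POITOU–TATE DUALITY** — the lead's `signedControl_two_allCurves_of_print2NTY` fed with
`h1SigmaDualNotTorsion_two_of_poitouTate_of_goodSS`: the (I1) conjunct of `stub_pubGreenbergI1Two` is replaced by the
tree's canonical `poitouTate_selmerStructure_duality ℚ`. Conditional on the three named facts; the crux binders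
`¬ W.HasCM`, `W.analyticRank = 0` are not used. [cite: GreenbergLNM1716, §4 Props. 4.12–4.13, pp. 113, 115–122]
[cite: MilneADT2006, Ch. I, Thm. 4.10] [cite: BDKim2013, Cor. 3.15] [cite: Kobayashi2003, Thm. 1.2] -/
theorem signedControlAtTwo_of_pub2_of_poitouTate (hC : Greenberg1999.casselsSurjectivity_H1Sigma ℚ)
    (h412 : Greenberg1999.prop412_noFiniteSubmodule_H1Sigma_of_rank_one)
    (hPT : poitouTate_selmerStructure_duality ℚ) :
    Summit.BirchSwinnertonDyer.BirchSwinnertonDyer.Theses.ThetaPartnerAtTwo.SignedControlAtTwo := by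
  intro W _ _ _ _ hss ha
  exact signedControl_two_allCurves_of_print2NTY W hC h412
    (fun κ _ _ hγ S₀ hgood ↦ h1SigmaDualNotTorsion_two_of_poitouTate_of_goodSS W hss hPT κ hγ S₀ hgood) hss ha

/-- **The same for route `ResidualThetaTransportAtTwo`'s copy of the decl** (identical body).
[cite: GreenbergLNM1716, §4 Props. 4.12–4.13, pp. 113, 115–122] [cite: MilneADT2006, Ch. I, Thm. 4.10] [cite: BDKim2013, Cor. 3.15] -/
theorem signedControlAtTwo_rtt_of_pub2_of_poitouTate (hC : Greenberg1999.casselsSurjectivity_H1Sigma ℚ)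
    (h412 : Greenberg1999.prop412_noFiniteSubmodule_H1Sigma_of_rank_one)
    (hPT : poitouTate_selmerStructure_duality ℚ) :
    Summit.BirchSwinnertonDyer.BirchSwinnertonDyer.Theses.ResidualThetaTransportAtTwo.SignedControlAtTwo := by
  intro W _ _ _ _ hss ha
  exact signedControl_two_allCurves_of_print2NTY W hC h412
    (fun κ _ _ hγ S₀ hgood ↦ h1SigmaDualNotTorsion_two_of_poitouTate_of_goodSS W hss hPT κ hγ S₀ hgood) hss ha

end Rat

end Summit.BirchSwinnertonDyer.BirchSwinnertonDyer.Theorems.SignedEC.TwistNotTorsion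

end
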